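import Summits.QuantumAdvantage.QuantumAdvantage.Theses.CompactnessLift
import Summits.QuantumAdvantage.QuantumAdvantage.Theorems.CompactnessLiftLanguageLadderSummitStrength
import Literature.Computability.Complexity.RelativizedTime
import Literature.Computability.QuantumComplexity.BQTime

/-!
# Route CompactnessLift · crux `LanguageLadder` (stmt-QuantumAdvantage-15271) — the honest split

The typed crux is, by the tree theorem
`CompactnessLiftLanguageLadder.languageLadder_iff_not_BQTime_two_subset_BPP`, exactly
`¬ (BQTIME(n²) ⊆ BPP)` (the summit in the quadratic-padding window). It factors EXACTLY into the
pair of statements the route was designed around, re-typed over the honest fixed-exponent class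
`BPTime` of `RelativizedTime.lean` (coins `O(n^c)` AND time `O(n^c)`), as every reading of the item
recommended (refuter rattack-15271 `C′`, lead verdicts of seats 0 and c1, census cstrat-b1, Disproof §6):

* the **uniform-exponent lift** (compactness principle on the quadratic window)
  `BQTime (·^2) ⊆ BPP → ∃ c, BQTime (·^2) ⊆ BPTime (·^c)` — "a dequantization of the quadratic
  quantum deciders, if it exists at all, has ONE exponent"; and
* the **fixed-exponent language ladder** `∀ c, ∃ L ∈ BQTime (·^2), L ∉ BPTime (·^c)` — the
  hypothesis-type ladder the item was meant to state.

`languageLadder_of_subs` is the glue `lift → ladder → LanguageLadder` for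
`ledger route edit … --split LanguageLadder --glue-by`; `languageLadder_iff_lift_and_ladder` shows
the split loses nothing; `lift_iff_ladder_imp` records that the lift is precisely the bridge
"ladder → crux" (a bridge split `T ∧ (T → X)` with `T` open and `T → X` the route's open
relativization question, item 15277 OracleDichotomy).

References: S. Arora, B. Barak, *Computational Complexity: A Modern Approach*, CUP 2009, Def. 7.2
(BPTIME) [AroraBarakCC2009]; E. Bernstein, U. Vazirani, SIAM J. Comput. 26 (1997) §8.1 (BQTime(T))
[BernsteinVazirani1997SICOMP]; L. Fortnow, J. Rogers, JCSS 59 (1999) Cor. 3.7 [FortnowRogers1999JCSS].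
-/

set_option linter.dupNamespace false

namespace Summit.QuantumAdvantage.QuantumAdvantage.Theorems.CompactnessLiftLanguageLadderSplit

open Literature.Computability.Complexity Literature.Computability.QuantumComplexity
open Summit.QuantumAdvantage.QuantumAdvantage.Theses.CompactnessLift
open Summit.QuantumAdvantage.QuantumAdvantage.Theorems.CompactnessLiftLanguageLadder

/-- **Glue of the split** `LanguageLadder ⇐ lift ∧ ladder`: if every quadratic-uniform quantum
language were in `BPP`, the lift gives one exponent `c` for all of them and the ladder's rung `c`
exhibits one outside `BPTIME(n^c)` — contradiction; and `LanguageLadder` is `¬ (BQTime (·^2) ⊆ BPP)`.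
[folklore] -/
theorem languageLadder_of_subs
    (h₁ : BQTime (fun n => n ^ 2) ⊆ BPP → ∃ c : ℕ, BQTime (fun n => n ^ 2) ⊆ BPTime (fun n => n ^ c))
    (h₂ : ∀ c : ℕ, ∃ L ∈ BQTime (fun n => n ^ 2), L ∉ BPTime (fun n => n ^ c)) :
    LanguageLadder := by
  rw [languageLadder_iff_not_BQTime_two_subset_BPP]
  intro hsub
  obtain ⟨c, hc⟩ := h₁ hsub
  obtain ⟨L, hL, hLc⟩ := h₂ c
  exact hLc (hc hL)

/-- The crux gives the lift back (vacuously: the crux is `¬` its antecedent). [folklore] -/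
theorem lift_of_languageLadder (h : LanguageLadder) :
    BQTime (fun n => n ^ 2) ⊆ BPP → ∃ c : ℕ, BQTime (fun n => n ^ 2) ⊆ BPTime (fun n => n ^ c) :=
  fun hsub => absurd hsub (languageLadder_iff_not_BQTime_two_subset_BPP.1 h)

/-- The crux gives the honest ladder back (`BPTime (·^c) ⊆ BPP`, tree `BPTime_pow_subset_BPP`):
typed ⟹ repaired, unconditionally. [folklore] -/
theorem ladder_of_languageLadder (h : LanguageLadder) :
    ∀ c : ℕ, ∃ L ∈ BQTime (fun n => n ^ 2), L ∉ BPTime (fun n => n ^ c) := by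
  have hX := languageLadder_iff_not_BQTime_two_subset_BPP.1 h
  intro c
  by_contra hc
  push Not at hc
  exact hX fun L hL => BPTime_pow_subset_BPP c (hc L hL)

/-- **The split is exact**: `LanguageLadder ↔ lift ∧ ladder`. [folklore] -/
theorem languageLadder_iff_lift_and_ladder :
    LanguageLadder ↔
      (BQTime (fun n => n ^ 2) ⊆ BPP → ∃ c : ℕ, BQTime (fun n => n ^ 2) ⊆ BPTime (fun n => n ^ c)) ∧
      (∀ c : ℕ, ∃ L ∈ BQTime (fun n => n ^ 2), L ∉ BPTime (fun n => n ^ c)) :=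
  ⟨fun h => ⟨lift_of_languageLadder h, ladder_of_languageLadder h⟩,
    fun h => languageLadder_of_subs h.1 h.2⟩

/-- **The lift is exactly the bridge "ladder → crux"** (pure logic over the landed iff): the split
is a bridge split `T ∧ (T → LanguageLadder)` with `T` the honest ladder. [folklore] -/
theorem lift_iff_ladder_imp :
    (BQTime (fun n => n ^ 2) ⊆ BPP → ∃ c : ℕ, BQTime (fun n => n ^ 2) ⊆ BPTime (fun n => n ^ c)) ↔
      ((∀ c : ℕ, ∃ L ∈ BQTime (fun n => n ^ 2), L ∉ BPTime (fun n => n ^ c)) → LanguageLadder) := by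
  constructor
  · exact fun h₁ h₂ => languageLadder_of_subs h₁ h₂
  · intro h hsub
    by_contra hno
    push Not at hno
    exact (languageLadder_iff_not_BQTime_two_subset_BPP.1 (h fun c => Set.not_subset.1 (hno c))) hsub

end Summit.QuantumAdvantage.QuantumAdvantage.Theorems.CompactnessLiftLanguageLadderSplit
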